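import Summits.CriticalPhenomena.PercolationContinuityZ3.Theorems.Transplant.DkSKDefs
import Summits.CriticalPhenomena.PercolationContinuityZ3.Theorems.Transplant.D4SKGeo
import HarnessLib

/-!
# Diamond films `D_k` certificate (generic thickness), II: SOUNDNESS OF THE BITBOARD PRIMITIVES — neighbourhood masks are made of bonds, reachable bits are ends of index
walks, re-validated index lists are duplicate-free adjacency chains

builds on p205010 (kernel theorem, internal audit signed; external expert review pending) — NOT used in this file.  Lane `prim-bschramm`, seat `prim-bschramm-p2` (gen 43; class C1b;
memo `HOME/bschramm/P2-LATTICES.md` §152); helper file (`--supports stmt-CriticalPhenomena-4575 --as helper`).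
«D4SKBits» for the thickness-generic layout of «DkSKDefs» (digit arithmetic `digit_eq` reused from «D4SKGeo»): the residue class and height of an index in arithmetic form (`res_cases`, `adjB_iff`), **`testBit_nbh`** (a bit of
`C.nbh m` is a universe vertex adjacent to a bit of `m` — the one layout-specific proof: horizontal shifts by `12` at the same tag, vertical shifts by `1` at the same tag between the
residues `1, 2`, and with re-tagging by `144` between the residues `3, 0`), then verbatim: `IsWalkIn`, `reachGo_sound`, **`reach_sound`**, **`pathOK_sound`**.
[cite: DuminilCopinSidoraviciusTassion2016, §2.3 (proof of Fact 2)]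
-/

namespace Summit.CriticalPhenomena.PercolationContinuityZ3.Theorems.Transplant

namespace DiamondFilm.DK

open Slab111.SK (bitOf sdiff lowIdx maskBelow maskOfList endsOK orFold rd rdMask testBit_bitOf testBit_sdiff testBit_maskBelow of_testBit_maskBelow testBit_maskBelow_of)
open DiamondFilm.SK (dT dA dB digit_eq)

/-! ## §1 Digits, residues, heights, adjacency -/

/-- Index adjacency as a proposition (the context's `adjB`). [folklore] -/
def AdjRel (C : DCtx) (i j : ℕ) : Prop := C.adjB i j = true

/-- **The residue class of an index, arithmetically** (with the parity bits of its column). [folklore] -/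
theorem res_cases (C : DCtx) (i : ℕ) :
    ((C.c0 + dA i + 1) % 2 = 0 ∧ (C.c1 + dB i + 1) % 2 = 0 ∧ C.res i = 0) ∨ ((C.c0 + dA i + 1) % 2 = 1 ∧ (C.c1 + dB i + 1) % 2 = 0 ∧ C.res i = 1) ∨
      ((C.c0 + dA i + 1) % 2 = 1 ∧ (C.c1 + dB i + 1) % 2 = 1 ∧ C.res i = 2) ∨ ((C.c0 + dA i + 1) % 2 = 0 ∧ (C.c1 + dB i + 1) % 2 = 1 ∧ C.res i = 3) := by
  unfold DCtx.res DCtx.px DCtx.py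
  have h0 : (C.c0 + dA i + 1) % 2 = 0 ∨ (C.c0 + dA i + 1) % 2 = 1 := Nat.mod_two_eq_zero_or_one _
  have h1 : (C.c1 + dB i + 1) % 2 = 0 ∨ (C.c1 + dB i + 1) % 2 = 1 := Nat.mod_two_eq_zero_or_one _
  rcases h0 with h0 | h0 <;> rcases h1 with h1 | h1 <;> simp [h0, h1]

/-- The height of an index is `4·t + r`. [folklore] -/
theorem hgt_eq (C : DCtx) (i : ℕ) : C.hgt i = 4 * dT i + C.res i := rfl

/-- `validB` in arithmetic form. [folklore] -/
theorem validB_iff (C : DCtx) (i : ℕ) : C.validB i = true ↔ i < C.N ∧ dA i ≤ 10 ∧ dB i ≤ 10 ∧ C.hgt i ≤ C.k := by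
  unfold DCtx.validB
  simp only [Bool.and_eq_true, decide_eq_true_eq, and_assoc]

/-- The arithmetic digit bounds of a valid index. [folklore] -/
theorem digits (C : DCtx) (i : ℕ) (h : C.validB i = true) : i < C.N ∧ (i % 144) / 12 ≤ 10 ∧ i % 12 ≤ 10 := by
  have := (validB_iff C i).1 h; exact ⟨this.1, this.2.1, this.2.2.1⟩

/-- `adjB` in arithmetic form. [folklore] -/
theorem adjB_iff (C : DCtx) {i j : ℕ} : C.adjB i j = true ↔ C.validB i = true ∧ C.validB j = true ∧ (C.hgt i + 1 = C.hgt j ∨ C.hgt j + 1 = C.hgt i) ∧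
    ((min (C.hgt i) (C.hgt j) % 2 = 0 ∧ dB i = dB j ∧ (dA i = dA j + 1 ∨ dA j = dA i + 1)) ∨
      (min (C.hgt i) (C.hgt j) % 2 = 1 ∧ dA i = dA j ∧ (dB i = dB j + 1 ∨ dB j = dB i + 1))) := by
  unfold DCtx.adjB
  cases hb : (min (C.hgt i) (C.hgt j) % 2 == 0)
  · have hm : min (C.hgt i) (C.hgt j) % 2 = 1 := by rw [beq_eq_false_iff_ne] at hb; omega
    simp only [Bool.and_eq_true, Bool.or_eq_true, beq_iff_eq, decide_eq_true_eq, cond_false]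
    constructor
    · rintro ⟨⟨⟨hi, hj⟩, hh⟩, ha, hb'⟩; exact ⟨hi, hj, hh, Or.inr ⟨hm, ha, hb'⟩⟩
    · rintro ⟨hi, hj, hh, ⟨h0, -, -⟩ | ⟨-, ha, hb'⟩⟩
      · omega
      · exact ⟨⟨⟨hi, hj⟩, hh⟩, ha, hb'⟩
  · have hm : min (C.hgt i) (C.hgt j) % 2 = 0 := by rw [beq_iff_eq] at hb; exact hb
    simp only [Bool.and_eq_true, Bool.or_eq_true, beq_iff_eq, decide_eq_true_eq, cond_true]
    constructor
    · rintro ⟨⟨⟨hi, hj⟩, hh⟩, hb', ha⟩; exact ⟨hi, hj, hh, Or.inl ⟨hm, hb', ha⟩⟩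
    · rintro ⟨hi, hj, hh, ⟨-, hb', ha⟩ | ⟨h1, -, -⟩⟩
      · exact ⟨⟨⟨hi, hj⟩, hh⟩, hb', ha⟩
      · omega

/-- `AdjRel` is symmetric. [folklore] -/
theorem AdjRel.symm {C : DCtx} {i j : ℕ} (h : AdjRel C i j) : AdjRel C j i := by
  unfold AdjRel at *
  rw [adjB_iff] at h ⊢
  obtain ⟨hi, hj, hh, h⟩ := h
  refine ⟨hj, hi, hh.symm, ?_⟩
  rw [min_comm]
  rcases h with ⟨h1, h2, h3⟩ | ⟨h1, h2, h3⟩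
  · exact Or.inl ⟨h1, h2.symm, h3.symm⟩
  · exact Or.inr ⟨h1, h2.symm, h3.symm⟩

/-- The residue only sees the column digits. [folklore] -/
theorem res_of_digits (C : DCtx) {i j : ℕ} (ha : dA i = dA j) (hb : dB i = dB j) : C.res i = C.res j := by
  unfold DCtx.res DCtx.px DCtx.py; rw [ha, hb]

/-! ## §2 Neighbourhoods and reachability -/

/-- Universe bits are the valid indices. [folklore] -/
theorem testBit_univ_iff (C : DCtx) (i : ℕ) : C.univ.testBit i = true ↔ C.validB i = true := by
  rw [DCtx.univ, testBit_maskBelow, Bool.and_eq_true, decide_eq_true_eq]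
  exact ⟨fun h => h.2, fun h => ⟨((validB_iff C i).1 h).1, h⟩⟩

/-- Bits of the residue-`0` mask. [folklore] -/
theorem testBit_CL0_iff (C : DCtx) (i : ℕ) : C.CL0.testBit i = true ↔ C.validB i = true ∧ C.res i = 0 := by
  rw [DCtx.CL0, testBit_maskBelow, Bool.and_eq_true, decide_eq_true_eq, Bool.and_eq_true, beq_iff_eq]
  exact ⟨fun h => h.2, fun h => ⟨((validB_iff C i).1 h.1).1, h⟩⟩

/-- Bits of the residue-`1,2` mask. [folklore] -/
theorem testBit_CL12_iff (C : DCtx) (i : ℕ) : C.CL12.testBit i = true ↔ C.validB i = true ∧ (C.res i = 1 ∨ C.res i = 2) := by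
  rw [DCtx.CL12, testBit_maskBelow, Bool.and_eq_true, decide_eq_true_eq, Bool.and_eq_true, Bool.or_eq_true, beq_iff_eq, beq_iff_eq]
  exact ⟨fun h => h.2, fun h => ⟨((validB_iff C i).1 h.1).1, h⟩⟩

/-- Bits of the residue-`3` mask. [folklore] -/
theorem testBit_CL3_iff (C : DCtx) (i : ℕ) : C.CL3.testBit i = true ↔ C.validB i = true ∧ C.res i = 3 := by
  rw [DCtx.CL3, testBit_maskBelow, Bool.and_eq_true, decide_eq_true_eq, Bool.and_eq_true, beq_iff_eq]
  exact ⟨fun h => h.2, fun h => ⟨((validB_iff C i).1 h.1).1, h⟩⟩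

/-- Bits of a two-sided unit shift. [folklore] -/
theorem testBit_shift1 {m j : ℕ} (h : ((m <<< 1) ||| (m >>> 1)).testBit j = true) : (1 ≤ j ∧ m.testBit (j - 1) = true) ∨ m.testBit (j + 1) = true := by
  rw [Nat.testBit_lor, Bool.or_eq_true, Nat.testBit_shiftLeft, Nat.testBit_shiftRight, Bool.and_eq_true, decide_eq_true_eq] at h
  rcases h with ⟨hge, h⟩ | h
  · exact Or.inl ⟨hge, h⟩
  · exact Or.inr (by rw [Nat.add_comm]; exact h)

/-- Bits of a two-sided shift by `12`. [folklore] -/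
theorem testBit_shift12 {m j : ℕ} (h : ((m <<< 12) ||| (m >>> 12)).testBit j = true) : (12 ≤ j ∧ m.testBit (j - 12) = true) ∨ m.testBit (j + 12) = true := by
  rw [Nat.testBit_lor, Bool.or_eq_true, Nat.testBit_shiftLeft, Nat.testBit_shiftRight, Bool.and_eq_true, decide_eq_true_eq] at h
  rcases h with ⟨hge, h⟩ | h
  · exact Or.inl ⟨hge, h⟩
  · exact Or.inr (by rw [Nat.add_comm]; exact h)

/-- **Two valid indices over horizontally adjacent columns at the same tag are adjacent** (heights `4t ↔ 4t+1` or `4t+3 ↔ 4t+2`). [cite: ConwaySloane1999, Ch. 4 §7.3] -/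
theorem adjB_of_horiz (C : DCtx) {i j : ℕ} (hi : C.validB i = true) (hj : C.validB j = true) (hij : j = i + 12 ∨ i = j + 12) : C.adjB i j = true := by
  have hdi := digits C i hi
  have hdj := digits C j hj
  obtain ⟨ai, bi, ti⟩ := digit_eq i
  obtain ⟨aj, bj, tj⟩ := digit_eq j
  have hb : dB i = dB j := by omega
  have ht : dT i = dT j := by omega
  have ha : dA i = dA j + 1 ∨ dA j = dA i + 1 := by omega
  have gi := res_cases C i
  have gj := res_cases C j
  have hgi := hgt_eq C i
  have hgj := hgt_eq C j
  rw [adjB_iff]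
  refine ⟨hi, hj, ?_, Or.inl ⟨?_, hb, ha⟩⟩
  · rcases gi with ⟨p1, q1, r1⟩ | ⟨p1, q1, r1⟩ | ⟨p1, q1, r1⟩ | ⟨p1, q1, r1⟩ <;>
      rcases gj with ⟨p2, q2, r2⟩ | ⟨p2, q2, r2⟩ | ⟨p2, q2, r2⟩ | ⟨p2, q2, r2⟩ <;> omega
  · rcases gi with ⟨p1, q1, r1⟩ | ⟨p1, q1, r1⟩ | ⟨p1, q1, r1⟩ | ⟨p1, q1, r1⟩ <;>
      rcases gj with ⟨p2, q2, r2⟩ | ⟨p2, q2, r2⟩ | ⟨p2, q2, r2⟩ | ⟨p2, q2, r2⟩ <;> omega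

/-- **Two valid indices of residues `1, 2` over vertically adjacent columns at the same tag are adjacent** (heights `4t+1 ↔ 4t+2`). [cite: ConwaySloane1999, Ch. 4 §7.3] -/
theorem adjB_of_vert12 (C : DCtx) {i j : ℕ} (hi : C.validB i = true) (hj : C.validB j = true) (hrj : C.res j = 1 ∨ C.res j = 2)
    (hij : j = i + 1 ∨ i = j + 1) : C.adjB i j = true := by
  have hdi := digits C i hi
  have hdj := digits C j hj
  obtain ⟨ai, bi, ti⟩ := digit_eq i
  obtain ⟨aj, bj, tj⟩ := digit_eq j
  have ha : dA i = dA j := by omega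
  have ht : dT i = dT j := by omega
  have hb : dB i = dB j + 1 ∨ dB j = dB i + 1 := by omega
  have gi := res_cases C i
  have gj := res_cases C j
  have hgi := hgt_eq C i
  have hgj := hgt_eq C j
  rw [adjB_iff]
  refine ⟨hi, hj, ?_, Or.inr ⟨?_, ha, hb⟩⟩
  · rcases gi with ⟨p1, q1, r1⟩ | ⟨p1, q1, r1⟩ | ⟨p1, q1, r1⟩ | ⟨p1, q1, r1⟩ <;>
      rcases gj with ⟨p2, q2, r2⟩ | ⟨p2, q2, r2⟩ | ⟨p2, q2, r2⟩ | ⟨p2, q2, r2⟩ <;> omega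
  · rcases gi with ⟨p1, q1, r1⟩ | ⟨p1, q1, r1⟩ | ⟨p1, q1, r1⟩ | ⟨p1, q1, r1⟩ <;>
      rcases gj with ⟨p2, q2, r2⟩ | ⟨p2, q2, r2⟩ | ⟨p2, q2, r2⟩ | ⟨p2, q2, r2⟩ <;> omega

/-- **A valid index of residue `3` and a valid index of residue `0` one tag higher over a vertically adjacent column are adjacent** (heights `4t+3 ↔ 4t+4`). [cite: ConwaySloane1999, Ch. 4 §7.3] -/
theorem adjB_of_vert30 (C : DCtx) {i j : ℕ} (hi : C.validB i = true) (hj : C.validB j = true) (hri : C.res i = 3) (hrj : C.res j = 0)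
    (hij : j = i + 144 + 1 ∨ i + 144 = j + 1) : C.adjB i j = true := by
  have hdi := digits C i hi
  have hdj := digits C j hj
  obtain ⟨ai, bi, ti⟩ := digit_eq i
  obtain ⟨aj, bj, tj⟩ := digit_eq j
  have ha : dA i = dA j := by omega
  have ht : dT j = dT i + 1 := by omega
  have hb : dB i = dB j + 1 ∨ dB j = dB i + 1 := by omega
  have hgi := hgt_eq C i
  have hgj := hgt_eq C j
  rw [adjB_iff]
  exact ⟨hi, hj, by omega, Or.inr ⟨by omega, ha, hb⟩⟩

/-- **A bit of the neighbourhood mask has an adjacent bit in the argument** (and lies in the universe). [folklore] -/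
theorem testBit_nbh (C : DCtx) {m j : ℕ} (h : (C.nbh m).testBit j = true) : C.univ.testBit j = true ∧ ∃ i, m.testBit i = true ∧ AdjRel C i j := by
  unfold DCtx.nbh at h
  rw [Nat.testBit_land, Bool.and_eq_true] at h
  refine ⟨h.2, ?_⟩
  have hu : C.validB j = true := (testBit_univ_iff C j).1 h.2
  have h1 := h.1
  unfold AdjRel
  -- a bit of `m ∩ univ` is a valid bit of `m`
  have hmu : ∀ i, (m &&& C.univ).testBit i = true → m.testBit i = true ∧ C.validB i = true := by
    intro i hi
    rw [Nat.testBit_land, Bool.and_eq_true] at hi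
    exact ⟨hi.1, (testBit_univ_iff C i).1 hi.2⟩
  rw [Nat.testBit_lor, Bool.or_eq_true, Nat.testBit_lor, Bool.or_eq_true, Nat.testBit_lor, Bool.or_eq_true] at h1
  rcases h1 with ((h1 | h1) | h1) | h1
  · -- horizontal part
    rw [Nat.testBit_land, Bool.and_eq_true] at h1
    rcases testBit_shift12 h1.1 with ⟨hge, hs⟩ | hs
    · obtain ⟨hm, hv⟩ := hmu _ hs
      exact ⟨j - 12, hm, adjB_of_horiz C hv hu (Or.inl (by omega))⟩
    · obtain ⟨hm, hv⟩ := hmu _ hs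
      exact ⟨j + 12, hm, adjB_of_horiz C hv hu (Or.inr rfl)⟩
  · -- vertical part, residues `1, 2`
    rw [Nat.testBit_land, Bool.and_eq_true] at h1
    obtain ⟨hs, hj12⟩ := h1
    obtain ⟨-, hrj⟩ := (testBit_CL12_iff C j).1 hj12
    have aux : ∀ i, (m &&& C.univ &&& C.CL12).testBit i = true → m.testBit i = true ∧ C.validB i = true ∧ (C.res i = 1 ∨ C.res i = 2) := by
      intro i hi
      rw [Nat.testBit_land, Bool.and_eq_true] at hi
      obtain ⟨hm, hv⟩ := hmu i hi.1
      exact ⟨hm, hv, ((testBit_CL12_iff C i).1 hi.2).2⟩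
    rcases testBit_shift1 hs with ⟨hge, hs⟩ | hs
    · obtain ⟨hm, hv, -⟩ := aux _ hs
      exact ⟨j - 1, hm, adjB_of_vert12 C hv hu hrj (Or.inl (by omega))⟩
    · obtain ⟨hm, hv, -⟩ := aux _ hs
      exact ⟨j + 1, hm, adjB_of_vert12 C hv hu hrj (Or.inr rfl)⟩
  · -- vertical part, residue `3` up to residue `0`
    rw [Nat.testBit_land, Bool.and_eq_true, Nat.testBit_shiftLeft, Bool.and_eq_true, decide_eq_true_eq] at h1
    obtain ⟨⟨hge, hs⟩, hj0⟩ := h1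
    obtain ⟨-, hrj⟩ := (testBit_CL0_iff C j).1 hj0
    have aux : ∀ i, (m &&& C.univ &&& C.CL3).testBit i = true → m.testBit i = true ∧ C.validB i = true ∧ C.res i = 3 := by
      intro i hi
      rw [Nat.testBit_land, Bool.and_eq_true] at hi
      obtain ⟨hm, hv⟩ := hmu i hi.1
      exact ⟨hm, hv, ((testBit_CL3_iff C i).1 hi.2).2⟩
    rcases testBit_shift1 hs with ⟨hge1, hs⟩ | hs
    · obtain ⟨hm, hv, hri⟩ := aux _ hs
      exact ⟨j - 144 - 1, hm, adjB_of_vert30 C hv hu hri hrj (Or.inl (by omega))⟩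
    · obtain ⟨hm, hv, hri⟩ := aux _ hs
      exact ⟨j - 144 + 1, hm, adjB_of_vert30 C hv hu hri hrj (Or.inr (by omega))⟩
  · -- vertical part, residue `0` down to residue `3`
    rw [Nat.testBit_land, Bool.and_eq_true] at h1
    obtain ⟨hs, hj3⟩ := h1
    obtain ⟨-, hrj⟩ := (testBit_CL3_iff C j).1 hj3
    have aux : ∀ i, ((m &&& C.univ &&& C.CL0) >>> 144).testBit i = true → m.testBit (i + 144) = true ∧ C.validB (i + 144) = true ∧ C.res (i + 144) = 0 := by
      intro i hi
      rw [Nat.testBit_shiftRight, Nat.testBit_land, Bool.and_eq_true] at hi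
      rw [Nat.add_comm]
      obtain ⟨hm, hv⟩ := hmu _ hi.1
      exact ⟨hm, hv, ((testBit_CL0_iff C _).1 hi.2).2⟩
    rcases testBit_shift1 hs with ⟨hge1, hs⟩ | hs
    · obtain ⟨hm, hv, hri⟩ := aux _ hs
      refine ⟨j - 1 + 144, hm, ?_⟩
      have := adjB_of_vert30 C hu hv hrj hri (Or.inr (by omega))
      exact (AdjRel.symm (C := C) this)
    · obtain ⟨hm, hv, hri⟩ := aux _ hs
      refine ⟨j + 1 + 144, hm, ?_⟩
      have := adjB_of_vert30 C hu hv hrj hri (Or.inl (by omega))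
      exact (AdjRel.symm (C := C) this)

/-- **An index walk inside a region**: an `AdjRel`-chain `s :: l` all of whose members are bits of `R`. [folklore] -/
def IsWalkIn (C : DCtx) (R : ℕ) (s : ℕ) (l : List ℕ) : Prop := (s :: l).IsChain (AdjRel C) ∧ ∀ x ∈ s :: l, R.testBit x = true

/-- The end of the walk `s :: l`. [folklore] -/
def walkEnd (s : ℕ) (l : List ℕ) : ℕ := (s :: l).getLast (List.cons_ne_nil _ _)

/-- Extending a walk by an adjacent region vertex. [folklore] -/
theorem IsWalkIn.snoc {C : DCtx} {R s : ℕ} {l : List ℕ} (h : IsWalkIn C R s l) {j : ℕ} (hadj : AdjRel C (walkEnd s l) j) (hj : R.testBit j = true) :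
    IsWalkIn C R s (l ++ [j]) ∧ walkEnd s (l ++ [j]) = j := by
  refine ⟨⟨?_, ?_⟩, ?_⟩
  · have : s :: (l ++ [j]) = (s :: l) ++ [j] := rfl
    rw [this, List.isChain_append]
    refine ⟨h.1, List.IsChain.singleton _, fun x hx y hy => ?_⟩
    rw [List.getLast?_eq_some_getLast (List.cons_ne_nil _ _), Option.mem_def, Option.some.injEq] at hx
    simp only [List.head?_cons, Option.mem_def, Option.some.injEq] at hy
    subst hx hy; exact hadj
  · intro x hx
    simp only [List.mem_cons, List.mem_append, List.not_mem_nil, or_false] at hx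
    rcases hx with rfl | hx | rfl
    · exact h.2 _ (by simp)
    · exact h.2 _ (List.mem_cons_of_mem _ hx)
    · exact hj
  · show ((s :: l) ++ [j]).getLast _ = j
    simp

/-- **SOUNDNESS OF `reachGo`** for the thickness-generic context. [folklore] -/
theorem reachGo_sound (C : DCtx) (R src : ℕ) :
    ∀ (f cur : ℕ), (∀ j, cur.testBit j = true → ∃ s l, src.testBit s = true ∧ IsWalkIn C R s l ∧ walkEnd s l = j) →
      ∀ j, (C.reachGo R f cur).testBit j = true → ∃ s l, src.testBit s = true ∧ IsWalkIn C R s l ∧ walkEnd s l = j := by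
  intro f
  induction f with
  | zero => intro cur hcur j hj; exact hcur j hj
  | succ f ih =>
    intro cur hcur j hj
    simp only [DCtx.reachGo] at hj
    have hnxt : ∀ j, ((cur ||| C.nbh cur) &&& R).testBit j = true → ∃ s l, src.testBit s = true ∧ IsWalkIn C R s l ∧ walkEnd s l = j := by
      intro j hj
      rw [Nat.testBit_land, Bool.and_eq_true, Nat.testBit_lor, Bool.or_eq_true] at hj
      rcases hj with ⟨hj | hj, hR⟩
      · exact hcur j hj
      · obtain ⟨-, i, hi, hadj⟩ := testBit_nbh C hj
        obtain ⟨s, l, hs, hw, he⟩ := hcur i hi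
        subst he
        exact ⟨s, l ++ [j], hs, (hw.snoc hadj hR).1, (hw.snoc hadj hR).2⟩
    cases hb : ((cur ||| C.nbh cur) &&& R == cur)
    · rw [hb] at hj; exact ih _ hnxt j hj
    · rw [hb] at hj; exact hcur j hj

/-- **SOUNDNESS OF `reach`** for the thickness-generic context: a reachable bit is the end of an index walk inside the region from a bit of `src ∩ region`. [folklore] -/
theorem reach_sound (C : DCtx) {R src j : ℕ} (h : (C.reach R src).testBit j = true) :
    ∃ s l, src.testBit s = true ∧ R.testBit s = true ∧ IsWalkIn C R s l ∧ walkEnd s l = j := by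
  unfold DCtx.reach at h
  have base : ∀ j, (src &&& R).testBit j = true → ∃ s l, (src &&& R).testBit s = true ∧ IsWalkIn C R s l ∧ walkEnd s l = j := by
    intro j hj
    refine ⟨j, [], hj, ⟨List.IsChain.singleton _, fun x hx => ?_⟩, rfl⟩
    simp only [List.mem_cons, List.not_mem_nil, or_false] at hx
    subst hx
    rw [Nat.testBit_land, Bool.and_eq_true] at hj
    exact hj.2
  obtain ⟨s, l, hs, hw, he⟩ := reachGo_sound C R (src &&& R) 300 _ base j h
  rw [Nat.testBit_land, Bool.and_eq_true] at hs
  exact ⟨s, l, hs.1, hs.2, hw, he⟩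

/-! ## §3 Re-validated paths -/

/-- **SOUNDNESS OF `pathOK`** for the thickness-generic context: an `AdjRel`-chain without repetitions, inside `reg`, off `seen`. [folklore] -/
theorem pathOK_sound (C : DCtx) (reg : ℕ) : ∀ (l : List ℕ) (seen : ℕ), C.pathOK reg l seen = true →
    l.IsChain (AdjRel C) ∧ l.Nodup ∧ ∀ x ∈ l, reg.testBit x = true ∧ seen.testBit x = false
  | [], _, _ => ⟨List.IsChain.nil, List.nodup_nil, fun _ h => nomatch h⟩
  | [i], seen, h => by
    simp only [DCtx.pathOK, Bool.and_eq_true, Bool.not_eq_true'] at h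
    exact ⟨List.IsChain.singleton _, List.nodup_singleton _, fun x hx => by simp only [List.mem_singleton] at hx; subst hx; exact h⟩
  | i :: j :: rest, seen, h => by
    simp only [DCtx.pathOK, Bool.and_eq_true, Bool.not_eq_true'] at h
    obtain ⟨⟨⟨hi, hsi⟩, hij⟩, hrest⟩ := h
    obtain ⟨hch, hnd, hmem⟩ := pathOK_sound C reg (j :: rest) (seen ||| bitOf i) hrest
    refine ⟨List.isChain_cons_cons.2 ⟨hij, hch⟩, List.nodup_cons.2 ⟨fun hmi => ?_, hnd⟩, fun x hx => ?_⟩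
    · have := (hmem i hmi).2
      rw [Nat.testBit_lor, testBit_bitOf] at this
      simp at this
    · rcases List.mem_cons.1 hx with rfl | hx
      · exact ⟨hi, hsi⟩
      · have := hmem x hx
        rw [Nat.testBit_lor, Bool.or_eq_false_iff] at this
        exact ⟨this.1, this.2.1⟩

end DiamondFilm.DK

end Summit.CriticalPhenomena.PercolationContinuityZ3.Theorems.Transplant
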